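import Literature.Analysis.FluidPDE.Tao2016AveragedNS.NegativeKickSharp
import Mathlib.Analysis.SpecialFunctions.ImproperIntegrals
import Mathlib.MeasureTheory.Integral.ExpDecay
import HarnessLib

/-!
# The negative-kick dud threshold is `√(π/2)·ε²e^{-M}/√M` to four figures (Tao 2016, §5.5)

HONEST FRAMING (cell `pub-fluidc`, blueprint seat 1, gen 14): low prior, high value-of-information
experiment on Tao's machine paradigm; NOT a claim that NS blows up.

NegativeKick.lean / NegativeKickSharp.lean exhibit, over the EXACT flow of a member
`delayCircuitWith K M ε` (standing hypotheses), a negative pre-load `-κ*` on the trigger of Tao's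
datum (5.6) whose flow line returns the trigger to ZERO at the end of the cycle (a dud:
`cycleEndTrigger K M ε κ* = 0`), with the one-sided information `κ* < 2ε²e^{-M}/√M`. The cell's
numerics (job j054490) put the threshold at `≈ 1.2533·ε²e^{-M}/√M`. This file proves the number:

* `cycleEndTrigger_pos_of_le` — for `0 ≤ κ ≤ (3133/2500)ε²e^{-M}/√M = 1.2532·ε²e^{-M}/√M` the
  cycle-end trigger is POSITIVE (no dud at or below `1.2532/√M` seeds);
* `cycleEndTrigger_neg_of_ge_fine` — for `(2507/2000)ε²e^{-M}/√M = 1.2535·ε²e^{-M}/√M ≤ κ ≤ 3ε²e^{-M}`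
  it is NEGATIVE;
* `exists_negativeKick_dud_pinned`, `negativeKick_dud_gt` — hence a dud exists in, and EVERY dud of
  pre-load at most three seeds lies in, the window `(1.2532, 1.2535)·ε²e^{-M}/√M`, which contains
  `√(π/2) = 1.25331…` and has relative width `2.4·10⁻⁴`;
* `cycleEndTrigger_pos_of_le_pow_five` — in particular NO trigger pre-load within the `q = 5`
  seed-scale budget `ε²e^{-M}/K⁵` (≤ `ε²e^{-M}/√M`, as `M ≤ K¹⁰`) produces a dud: the refuting
  witness of `PseudoOrbitTransitionSeed q`, `q ≤ 4` (NegativeKickSharp.lean §3) stops short of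
  `q = 5` by the factor `1.2532`, in every member and not only on Tao's tuning `M = K¹⁰`.

Mechanism. Along the flow line `X` from `kickInit (-κ)` the discounted trigger
`D(u) = c(u)e^{-G(u)}`, `G(u) = ∫₀ᵘ ε⁻¹Mb`, obeys `D(0) = -κ` and `D' = ε²e^{-M}a²e^{-G} ≥ 0`
(NegativeKick.lean §1). LOWER side (§3): on `[0,1]` energy conservation gives `a² ≥ 1 - η₁`,
`η₁ = ε² + 48e^{-M} ≤ 10⁻⁵`, and `b ≤ εu` gives `G(u) ≤ Mu²/2` (`NegKick.clockInt_le`), so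
`D(1) ≥ -κ + ε²e^{-M}(1-η₁)∫₀¹e^{-Mu²/2}du`, and the Gaussian window mass is bounded BELOW by
`√(π/(2M)) - 2e^{-M/2}/M ≥ 1.2533/√M` (§1: `integral_gaussian_Ioi` minus the tail
`∫₁^∞ e^{-Mu²/2} ≤ ∫₁^∞ e^{-Mu/2} = 2e^{-M/2}/M`, and `√(2π) ≥ 2.50662` from `π > 3.141592`); then
`D(2) ≥ D(1) > 0` by monotonicity. UPPER side (§4): the clock floor of NegativeKickSharp.lean with its
constants kept honest (`G(u) ≥ ρMu²/2`, `ρ ≥ 1 - 10⁻⁵` instead of `49/50`) in `disc_two_le_sharp`,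
the Gaussian bound `√(π/λ)/2` with `√(2π) ≤ 2.50663`, and a tail `e^{1/20-λ} ≤ 10⁻⁵/√M`.
-/

namespace Literature.Analysis.FluidPDE.Tao2016AveragedNS

open Real Set MeasureTheory NegKick
open scoped NNReal

namespace NegKick

/-! ## §1. The Gaussian window mass from below, and the numerical constants -/

/-- **Gaussian window mass from below**: `∫₀¹ e^{-br²} dr ≥ √(π/b)/2 - e^{-b}/b` for `b > 0`
(the half-line Gaussian integral minus the tail `∫₁^∞ e^{-br²} ≤ ∫₁^∞ e^{-br} = e^{-b}/b`). [folklore] -/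
theorem integral_exp_neg_mul_sq_ge {b : ℝ} (hb : 0 < b) :
    Real.sqrt (π / b) / 2 - exp (-b) / b ≤ ∫ r in (0 : ℝ)..1, exp (-b * r ^ 2) := by
  have hint : Integrable fun x : ℝ => exp (-b * x ^ 2) := integrable_exp_neg_mul_sq hb
  have hdisj : Disjoint (Ioc (0 : ℝ) 1) (Ioi 1) :=
    disjoint_left.2 fun x hx hx' => (not_lt.2 hx.2) hx'
  have hsplit : ∫ x in Ioi (0 : ℝ), exp (-b * x ^ 2) =
      (∫ x in Ioc (0 : ℝ) 1, exp (-b * x ^ 2)) + ∫ x in Ioi (1 : ℝ), exp (-b * x ^ 2) := by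
    rw [← setIntegral_union hdisj measurableSet_Ioi hint.integrableOn hint.integrableOn,
      Ioc_union_Ioi_eq_Ioi zero_le_one]
  have htail : ∫ x in Ioi (1 : ℝ), exp (-b * x ^ 2) ≤ exp (-b) / b := by
    have h1 : ∫ x in Ioi (1 : ℝ), exp (-b * x ^ 2) ≤ ∫ x in Ioi (1 : ℝ), exp (-b * x) := by
      refine setIntegral_mono_on hint.integrableOn (exp_neg_integrableOn_Ioi 1 hb)
        measurableSet_Ioi fun x hx => ?_
      have hx1 : 1 ≤ x := le_of_lt hx
      have hx2 : x ≤ x ^ 2 := by nlinarith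
      exact exp_le_exp.2 (by nlinarith [mul_le_mul_of_nonneg_left hx2 hb.le])
    have h2 : ∫ x in Ioi (1 : ℝ), exp (-b * x) = exp (-b) / b := by
      rw [integral_exp_mul_Ioi (by linarith : -b < 0) 1, mul_one, neg_div_neg_eq]
    linarith
  have hIoi := integral_gaussian_Ioi b
  rw [intervalIntegral.integral_of_le zero_le_one]
  linarith

/-- `c/√M ≤ √(π/(M/2))/2` whenever `2c² ≤ π` (`c ≥ 0`, `M > 0`). [folklore] -/
theorem le_sqrt_pi_div {M c : ℝ} (hM : 0 < M) (hc : 0 ≤ c) (h : 2 * c ^ 2 ≤ π) :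
    c / Real.sqrt M ≤ Real.sqrt (π / (M / 2)) / 2 := by
  have hsq0 : 0 < Real.sqrt M := Real.sqrt_pos.2 hM
  have hkey : c ≤ Real.sqrt (2 * π) / 2 := by
    rw [le_div_iff₀ two_pos, Real.le_sqrt (by positivity) (by positivity)]
    nlinarith
  have hre : Real.sqrt (π / (M / 2)) = Real.sqrt (2 * π) / Real.sqrt M := by
    rw [show π / (M / 2) = 2 * π / M by rw [div_div_eq_mul_div]; ring, Real.sqrt_div' _ hM.le]
  rw [hre, div_le_iff₀ hsq0]
  calc c ≤ Real.sqrt (2 * π) / 2 := hkey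
    _ = Real.sqrt (2 * π) / Real.sqrt M / 2 * Real.sqrt M := by field_simp

/-- `√(π/λ)/2 ≤ c/√M` whenever `πM ≤ 4c²λ` (`c > 0`, `M > 0`). [folklore] -/
theorem sqrt_pi_div_le_of {M c l : ℝ} (hM : 0 < M) (hc : 0 < c) (hl : π * M ≤ 4 * c ^ 2 * l) :
    Real.sqrt (π / l) / 2 ≤ c / Real.sqrt M := by
  have hl0 : 0 < l := by
    by_contra h
    have h1 : 4 * c ^ 2 * l ≤ 0 := mul_nonpos_of_nonneg_of_nonpos (by positivity) (not_lt.1 h)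
    nlinarith [mul_pos Real.pi_pos hM]
  have hsq0 : 0 < Real.sqrt M := Real.sqrt_pos.2 hM
  rw [div_le_iff₀ two_pos, Real.sqrt_le_left (by positivity), mul_pow, div_pow, Real.sq_sqrt hM.le,
    div_le_iff₀ hl0]
  rw [show c ^ 2 / M * 2 ^ 2 * l = 4 * c ^ 2 * l / M by ring, le_div_iff₀ hM]
  exact hl

/-- The Gaussian tail constant: `e^{-M/2}/(M/2) ≤ 10⁻⁵/√M` for `M ≥ 6000`. [folklore] -/
theorem exp_half_div_le {M : ℝ} (hM : 6000 ≤ M) :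
    exp (-(M / 2)) / (M / 2) ≤ 1 / 100000 / Real.sqrt M := by
  have hM0 : 0 < M := by linarith
  have hsq0 : 0 < Real.sqrt M := Real.sqrt_pos.2 hM0
  have hsqM : Real.sqrt M ≤ M := by rw [Real.sqrt_le_left (by linarith)]; nlinarith
  have hq : M / 4 ≤ exp (M / 4) := by linarith [Real.add_one_le_exp (M / 4)]
  have h2 : (M / 4) ^ 2 ≤ exp (M / 2) := by
    have : exp (M / 2) = exp (M / 4) ^ 2 := by rw [← Real.exp_nat_mul]; ring_nf
    rw [this]; exact pow_le_pow_left₀ (by positivity) hq 2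
  have hbig : (200000 : ℝ) ≤ (M / 4) ^ 2 := by nlinarith
  rw [exp_neg]
  calc (exp (M / 2))⁻¹ / (M / 2) ≤ (200000 : ℝ)⁻¹ / (M / 2) := by
        gcongr
        exact hbig.trans h2
    _ = 1 / 100000 / M := by field_simp; ring
    _ ≤ 1 / 100000 / Real.sqrt M := div_le_div_of_nonneg_left (by norm_num) hsq0 hsqM

/-- The `[1,2]`-tail constant: `e^{1/20-λ} ≤ 10⁻⁵/√M` for `λ ≥ (499/1000)M`, `M ≥ 6000`. [folklore] -/
theorem exp_tail_le {M l : ℝ} (hM : 6000 ≤ M) (hl : 499 / 1000 * M ≤ l) :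
    exp (1 / 20 - l) ≤ 1 / 100000 / Real.sqrt M := by
  have hM0 : 0 < M := by linarith
  have hsq0 : 0 < Real.sqrt M := Real.sqrt_pos.2 hM0
  have hsqM : Real.sqrt M ≤ M := by rw [Real.sqrt_le_left (by linarith)]; nlinarith
  have hq0 : 0 ≤ 49 / 400 * M := by positivity
  have hq : 49 / 400 * M ≤ exp (49 / 400 * M) := by linarith [Real.add_one_le_exp (49 / 400 * M)]
  have h4 : (49 / 400 * M) ^ 4 ≤ exp (49 / 100 * M) := by
    have : exp (49 / 100 * M) = exp (49 / 400 * M) ^ 4 := by rw [← Real.exp_nat_mul]; ring_nf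
    rw [this]; exact pow_le_pow_left₀ hq0 hq 4
  have h735 : (735 : ℝ) ≤ 49 / 400 * M := by linarith
  have hpoly : 100000 * M ≤ (49 / 400 * M) ^ 4 := by
    have h3 : (735 : ℝ) ^ 3 ≤ (49 / 400 * M) ^ 3 := pow_le_pow_left₀ (by norm_num) h735 3
    have h3' : (735 : ℝ) ^ 3 * (49 / 400 * M) ≤ (49 / 400 * M) ^ 3 * (49 / 400 * M) :=
      mul_le_mul_of_nonneg_right h3 hq0
    nlinarith
  have hle : exp (1 / 20 - l) ≤ exp (-(49 / 100 * M)) := exp_le_exp.2 (by linarith)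
  refine hle.trans ?_
  rw [exp_neg]
  calc (exp (49 / 100 * M))⁻¹ ≤ ((49 / 400 * M) ^ 4)⁻¹ := inv_anti₀ (pow_pos (by linarith) 4) h4
    _ ≤ (100000 * M)⁻¹ := inv_anti₀ (by positivity) hpoly
    _ ≤ (100000 * Real.sqrt M)⁻¹ := inv_anti₀ (by positivity) (by gcongr)
    _ = 1 / 100000 / Real.sqrt M := by rw [div_div, one_div]

/-- **The window mass from below**: `∫₀¹ e^{-Mu²/2} du ≥ 1.2533/√M` for `M ≥ 6000`
(`√(2π)/2 ≥ 1.25331` from `π > 3.141592`, tail `≤ 10⁻⁵/√M`). [folklore] -/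
theorem window_mass_ge {M : ℝ} (hM : 6000 ≤ M) :
    12533 / 10000 / Real.sqrt M ≤ ∫ r in (0 : ℝ)..1, exp (-(M / 2) * r ^ 2) := by
  have hM0 : 0 < M := by linarith
  have h1 := integral_exp_neg_mul_sq_ge (b := M / 2) (by linarith)
  have h2 : 125331 / 100000 / Real.sqrt M ≤ Real.sqrt (π / (M / 2)) / 2 :=
    le_sqrt_pi_div hM0 (by norm_num) (by
      have := Real.pi_gt_d6
      norm_num at this ⊢
      linarith)
  have h3 := exp_half_div_le hM
  have h4 : (12533 : ℝ) / 10000 / Real.sqrt M =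
      125331 / 100000 / Real.sqrt M - 1 / 100000 / Real.sqrt M := by ring
  linarith

/-! ## §2. Fine parameter facts and the a-priori bounds on `[0,1]` -/

variable {K M ε κ : ℝ} {X : ℝ → Fin 5 → ℝ}

/-- Fine consequences of the standing hypotheses: `ε² ≤ e^{-M} ≤ 4/M² ≤ 1/(9·10⁶)`, `Me^{-M} ≤ 1`.
[cite: Tao2016AveragedNS, §5.5] -/
theorem negKick_params_fine (hK : 2 * 20 ^ 42 * (Nat.factorial 42 : ℝ) + 16 ≤ K)
    (hML : 3000 * Real.log K ≤ M) (hMK : M ≤ K ^ 10) (hε : 0 < ε)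
    (hεle : ε ≤ exp (-(10 * M)) / K ^ 100) :
    ε ^ 2 ≤ exp (-M) ∧ exp (-M) ≤ 4 / M ^ 2 ∧ 4 / M ^ 2 ≤ 1 / 9000000 ∧ M * exp (-M) ≤ 1 := by
  obtain ⟨hK16, hM4, hε1, -⟩ := negKick_params hK hML hMK hε hεle
  obtain ⟨hM6000, -⟩ := negKick_params_sharp hK hML hMK hε hεle
  have hM : 0 ≤ M := by linarith
  have hM0 : 0 < M := by linarith
  have hK1 : (1 : ℝ) ≤ K := by linarith
  have hεM : ε ≤ exp (-M) :=
    calc ε ≤ exp (-(10 * M)) / K ^ 100 := hεle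
      _ ≤ exp (-(10 * M)) := div_le_self (exp_pos _).le (one_le_pow₀ hK1)
      _ ≤ exp (-M) := exp_le_exp.2 (by linarith)
  refine ⟨?_, ?_, ?_, ?_⟩
  · calc ε ^ 2 = ε * ε := by ring
      _ ≤ 1 * exp (-M) := mul_le_mul hε1 hεM hε.le zero_le_one
      _ = exp (-M) := one_mul _
  · have hq : M / 2 ≤ exp (M / 2) := by linarith [Real.add_one_le_exp (M / 2)]
    have h2 : (M / 2) ^ 2 ≤ exp M := by
      have : exp M = exp (M / 2) ^ 2 := by rw [← Real.exp_nat_mul]; ring_nf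
      rw [this]; exact pow_le_pow_left₀ (by positivity) hq 2
    calc exp (-M) = (exp M)⁻¹ := exp_neg M
      _ ≤ ((M / 2) ^ 2)⁻¹ := inv_anti₀ (by positivity) h2
      _ = 4 / M ^ 2 := by field_simp; ring
  · rw [div_le_div_iff₀ (by positivity) (by norm_num)]
    nlinarith [mul_nonneg (sub_nonneg.2 hM6000) (by linarith : (0 : ℝ) ≤ M + 6000)]
  · calc M * exp (-M) ≤ exp M * exp (-M) := by
          gcongr; linarith [Real.add_one_le_exp M]
      _ = 1 := by rw [← exp_add]; simp

/-- **A-priori bounds on `[0,1]`** for a pre-load in `[-3ε²e^{-M}, 0]` under the standing hypotheses: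
`a² ≥ 1 - (ε² + 48e^{-M})` (energy one; `|b| ≤ ε`, `|c| ≤ 4ε²e^{-M/2}`, `|d|, |ã| ≤ 4e^{-M/2}`) and
`ε⁻¹Mc² ≤ ε·16Mε²e^{-M}`. [cite: Tao2016AveragedNS, §5.5] -/
theorem unit_apriori (hK : 2 * 20 ^ 42 * (Nat.factorial 42 : ℝ) + 16 ≤ K)
    (hML : 3000 * Real.log K ≤ M) (hMK : M ≤ K ^ 10) (hε : 0 < ε)
    (hεle : ε ≤ exp (-(10 * M)) / K ^ 100) (hX : ∀ t, HasDerivAt X (delayCircuitWith K M ε (X t)) t)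
    (h0 : X 0 = kickInit (-κ)) (hκ0 : 0 ≤ κ) (hκ3 : κ ≤ 3 * (ε ^ 2 * exp (-M))) :
    (∀ r ∈ Icc (0 : ℝ) 1, 1 - (ε ^ 2 + 48 * exp (-M)) ≤ X r 0 ^ 2) ∧
    (∀ r ∈ Icc (0 : ℝ) 1, ε⁻¹ * M * X r 2 ^ 2 ≤ ε * (16 * M * ε ^ 2 * exp (-M))) := by
  obtain ⟨hK16, hM4, hε1, hs3, hsmall, -⟩ := negKick_params hK hML hMK hε hεle
  obtain ⟨hM6000, hexpM, hε2, h16, hβε⟩ := negKick_params_sharp hK hML hMK hε hεle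
  have hM : 0 ≤ M := by linarith
  obtain ⟨s, hs⟩ : ∃ s : ℝ, s = ε ^ 2 * exp (-M) := ⟨_, rfl⟩
  have hs0 : 0 < s := by rw [hs]; positivity
  have hκsq : (-κ) ^ 2 ≤ 1 := by rw [neg_sq]; nlinarith
  have hκneg : -κ ≤ 0 := by linarith
  obtain ⟨-, hb, -⟩ := negKick_trajectory hK hML hMK hε hεle hX h0 hκ0 hκ3
  -- |c| ≤ 4 s e^{M/2} on [0,1]
  have hc1 : ∀ t ∈ Icc (0 : ℝ) 1, |X t 2| ≤ 4 * s * exp (M / 2) := fun t ht => by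
    have := abs_c_le_one hX h0 hκsq hκneg hM hε ht
    rw [neg_neg] at this
    refine this.trans ?_
    have : κ + ε ^ 2 * exp (-M) ≤ 4 * s := by rw [hs]; linarith
    exact mul_le_mul_of_nonneg_right this (exp_pos _).le
  -- |d|, |e| ≤ 4 e^{-M/2} on [0,1]
  have hde1 : ∀ t ∈ Icc (0 : ℝ) 1, |X t 3| ≤ 4 * exp (-(M / 2)) ∧ |X t 4| ≤ 4 * exp (-(M / 2)) :=
    fun t ht => by
    obtain ⟨hd, he⟩ := de_le hX h0 hκsq hε (by positivity) hc1 ht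
    have hC : (ε ^ 2)⁻¹ * (4 * s * exp (M / 2)) * t ≤ 4 * exp (-(M / 2)) := by
      have h1 : (ε ^ 2)⁻¹ * (4 * s * exp (M / 2)) = 4 * exp (-(M / 2)) := by
        have hee : exp (-M) * exp (M / 2) = exp (-(M / 2)) := by rw [← exp_add]; ring_nf
        have hε2 : ε ^ 2 ≠ 0 := by positivity
        calc (ε ^ 2)⁻¹ * (4 * s * exp (M / 2)) = 4 * (exp (-M) * exp (M / 2)) := by
              rw [hs]; field_simp
          _ = 4 * exp (-(M / 2)) := by rw [hee]
      rw [h1]; nlinarith [ht.2, exp_pos (-(M / 2))]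
    exact ⟨hd.trans hC, he.trans hC⟩
  have hsqe : s ^ 2 * exp M ≤ exp (-M) := by
    have h1 : s ^ 2 * exp M = ε ^ 4 * exp (-M) := by
      have hee : exp (-M) * exp (-M) * exp M = exp (-M) := by rw [← exp_add, ← exp_add]; ring_nf
      rw [hs]
      calc (ε ^ 2 * exp (-M)) ^ 2 * exp M = ε ^ 4 * (exp (-M) * exp (-M) * exp M) := by ring
        _ = ε ^ 4 * exp (-M) := by rw [hee]
    rw [h1]
    have : ε ^ 4 ≤ 1 := by nlinarith [sq_nonneg ε]
    nlinarith [exp_pos (-M)]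
  have heM2 : exp (-(M / 2)) ^ 2 = exp (-M) := by rw [← Real.exp_nat_mul]; ring_nf
  have heM2' : exp (M / 2) ^ 2 = exp M := by rw [← Real.exp_nat_mul]; ring_nf
  refine ⟨fun r hr => ?_, fun r hr => ?_⟩
  · rw [a_sq_eq hX h0 hκsq r]
    have hbu : X r 1 ≤ ε * r := kickW_b_le hX h0 hκsq hM hε.le hr.1
    have hbl : -(50 * M * ε ^ 3 * exp (2 * M)) ≤ X r 1 := hb r ⟨hr.1, by linarith [hr.2]⟩
    have hb2 : X r 1 ^ 2 ≤ ε ^ 2 := by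
      have h1 : X r 1 ≤ ε := by nlinarith [hr.2]
      have h2 : -ε ≤ X r 1 := by linarith
      nlinarith
    have hc2 : X r 2 ^ 2 ≤ 16 * exp (-M) := by
      have h1 := hc1 r hr
      have h2 : X r 2 ^ 2 ≤ (4 * s * exp (M / 2)) ^ 2 := by
        rw [← sq_abs]; exact pow_le_pow_left₀ (abs_nonneg _) h1 2
      have h3 : (4 * s * exp (M / 2)) ^ 2 = 16 * (s ^ 2 * exp M) := by rw [← heM2']; ring
      rw [h3] at h2
      nlinarith
    obtain ⟨hd, he⟩ := hde1 r hr
    have hd2 : X r 3 ^ 2 ≤ 16 * exp (-M) := by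
      have : X r 3 ^ 2 ≤ (4 * exp (-(M / 2))) ^ 2 := by
        rw [← sq_abs]; exact pow_le_pow_left₀ (abs_nonneg _) hd 2
      rw [mul_pow, heM2] at this; linarith
    have he2 : X r 4 ^ 2 ≤ 16 * exp (-M) := by
      have : X r 4 ^ 2 ≤ (4 * exp (-(M / 2))) ^ 2 := by
        rw [← sq_abs]; exact pow_le_pow_left₀ (abs_nonneg _) he 2
      rw [mul_pow, heM2] at this; linarith
    linarith
  · have h1 := hc1 r hr
    have h2 : X r 2 ^ 2 ≤ (4 * s * exp (M / 2)) ^ 2 := by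
      rw [← sq_abs]; exact pow_le_pow_left₀ (abs_nonneg _) h1 2
    have h3 : (4 * s * exp (M / 2)) ^ 2 = 16 * ε ^ 4 * exp (-M) := by
      have : (4 * s * exp (M / 2)) ^ 2 = 16 * (s ^ 2 * exp M) := by rw [← heM2']; ring
      rw [this, hs]
      have hee : exp (-M) * exp (-M) * exp M = exp (-M) := by rw [← exp_add, ← exp_add]; ring_nf
      calc 16 * ((ε ^ 2 * exp (-M)) ^ 2 * exp M) = 16 * ε ^ 4 * (exp (-M) * exp (-M) * exp M) := by
            ring
        _ = 16 * ε ^ 4 * exp (-M) := by rw [hee]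
    rw [h3] at h2
    have h4 : ε⁻¹ * M * X r 2 ^ 2 ≤ ε⁻¹ * M * (16 * ε ^ 4 * exp (-M)) :=
      mul_le_mul_of_nonneg_left h2 (by positivity)
    have h5 : ε⁻¹ * M * (16 * ε ^ 4 * exp (-M)) = ε * (16 * M * ε ^ 2 * exp (-M)) := by
      field_simp
    linarith

/-- **The honest clock floor on `[0,1]`**: `G(u) ≥ ρMu²/2` with
`ρ = 1 - (ε² + 48e^{-M}) - 16Mε²e^{-M}` (`≥ 1 - 10⁻⁵`). [cite: Tao2016AveragedNS, §5.5] -/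
theorem clockInt_ge_unit_fine (hK : 2 * 20 ^ 42 * (Nat.factorial 42 : ℝ) + 16 ≤ K)
    (hML : 3000 * Real.log K ≤ M) (hMK : M ≤ K ^ 10) (hε : 0 < ε)
    (hεle : ε ≤ exp (-(10 * M)) / K ^ 100) (hX : ∀ t, HasDerivAt X (delayCircuitWith K M ε (X t)) t)
    (h0 : X 0 = kickInit (-κ)) (hκ0 : 0 ≤ κ) (hκ3 : κ ≤ 3 * (ε ^ 2 * exp (-M))) :
    ∀ u ∈ Icc (0 : ℝ) 1,
      (1 - (ε ^ 2 + 48 * exp (-M)) - 16 * M * ε ^ 2 * exp (-M)) * M * u ^ 2 / 2 ≤ clockInt ε M X u := by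
  obtain ⟨-, hM4, -⟩ := negKick_params hK hML hMK hε hεle
  have hM : 0 ≤ M := by linarith
  obtain ⟨ha, hcM⟩ := unit_apriori hK hML hMK hε hεle hX h0 hκ0 hκ3
  intro u hu
  exact clockInt_ge hX hM hε (fun r hr => b_ge_linear hX h0 hε ha hcM hr) hu

/-! ## §3. The lower side: the deposit on `[0,1]` beats `1.2532/√M` seeds -/

/-- **The deposit on `[0,1]` from below**:
`c(1)e^{-G(1)} ≥ -κ + ε²e^{-M}(1 - η₁)∫₀¹ e^{-Mu²/2} du`, `η₁ = ε² + 48e^{-M}`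
(`D' = ε²e^{-M}a²e^{-G}` with `a² ≥ 1 - η₁` and `G(u) ≤ Mu²/2` on `[0,1]`).
[cite: Tao2016AveragedNS, §5.5 proof of Theorem 5.3] -/
theorem disc_one_ge (hK : 2 * 20 ^ 42 * (Nat.factorial 42 : ℝ) + 16 ≤ K)
    (hML : 3000 * Real.log K ≤ M) (hMK : M ≤ K ^ 10) (hε : 0 < ε)
    (hεle : ε ≤ exp (-(10 * M)) / K ^ 100) (hX : ∀ t, HasDerivAt X (delayCircuitWith K M ε (X t)) t)
    (h0 : X 0 = kickInit (-κ)) (hκ0 : 0 ≤ κ) (hκ3 : κ ≤ 3 * (ε ^ 2 * exp (-M))) :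
    -κ + ε ^ 2 * exp (-M) * (1 - (ε ^ 2 + 48 * exp (-M))) *
        ∫ r in (0 : ℝ)..1, exp (-(M / 2) * r ^ 2) ≤ X 1 2 * exp (-clockInt ε M X 1) := by
  obtain ⟨-, hM4, -, hs3, -⟩ := negKick_params hK hML hMK hε hεle
  obtain ⟨hε2M, hexp4, h4M, -⟩ := negKick_params_fine hK hML hMK hε hεle
  have hM : 0 ≤ M := by linarith
  have hκsq : (-κ) ^ 2 ≤ 1 := by rw [neg_sq]; nlinarith
  obtain ⟨ha, -⟩ := unit_apriori hK hML hMK hε hεle hX h0 hκ0 hκ3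
  have hη0 : 0 ≤ 1 - (ε ^ 2 + 48 * exp (-M)) := by linarith
  have hs0 : 0 ≤ ε ^ 2 * exp (-M) := by positivity
  have hcont : Continuous fun r : ℝ => exp (-(M / 2) * r ^ 2) := by fun_prop
  have hmono := Thm53.monotoneOn_sub_of_le_deriv (s := Icc (0 : ℝ) 1)
    (f := fun u => X u 2 * exp (-clockInt ε M X u))
    (f' := fun u => ε ^ 2 * exp (-M) * X u 0 ^ 2 * exp (-clockInt ε M X u))
    (φ := fun u => ε ^ 2 * exp (-M) * (1 - (ε ^ 2 + 48 * exp (-M))) * exp (-(M / 2) * u ^ 2))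
    (Φ := fun u => ε ^ 2 * exp (-M) * (1 - (ε ^ 2 + 48 * exp (-M))) *
      ∫ r in (0 : ℝ)..u, exp (-(M / 2) * r ^ 2))
    (convex_Icc 0 1)
    (fun u _ => hasDerivAt_disc hX u)
    (fun u _ => ((hcont.integral_hasStrictDerivAt 0 u).hasDerivAt).const_mul _)
    (fun u hu => by
      have h1 := ha u hu
      have h2 : exp (-(M / 2) * u ^ 2) ≤ exp (-clockInt ε M X u) := by
        apply exp_le_exp.2
        have := clockInt_le hX h0 hκsq hM hε hu.1
        linarith
      calc ε ^ 2 * exp (-M) * (1 - (ε ^ 2 + 48 * exp (-M))) * exp (-(M / 2) * u ^ 2)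
          ≤ ε ^ 2 * exp (-M) * X u 0 ^ 2 * exp (-clockInt ε M X u) :=
            mul_le_mul (mul_le_mul_of_nonneg_left h1 hs0) h2 (exp_pos _).le (by positivity))
  have h := hmono (left_mem_Icc.2 zero_le_one) (right_mem_Icc.2 zero_le_one) zero_le_one
  simp only [kick_init_c h0, clockInt_zero, neg_zero, exp_zero, mul_one,
    intervalIntegral.integral_same, mul_zero, sub_zero] at h
  linarith

/-- **The discounted trigger is positive at `u = 1`** for a pre-load `κ ≤ (3133/2500)ε²e^{-M}/√M`:
`(1 - 10⁻⁵)·1.2533 > 1.2532`. [cite: Tao2016AveragedNS, §5.5 proof of Theorem 5.3] -/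
theorem disc_one_pos (hK : 2 * 20 ^ 42 * (Nat.factorial 42 : ℝ) + 16 ≤ K)
    (hML : 3000 * Real.log K ≤ M) (hMK : M ≤ K ^ 10) (hε : 0 < ε)
    (hεle : ε ≤ exp (-(10 * M)) / K ^ 100) (hX : ∀ t, HasDerivAt X (delayCircuitWith K M ε (X t)) t)
    (h0 : X 0 = kickInit (-κ)) (hκ0 : 0 ≤ κ)
    (hκ : κ ≤ 3133 / 2500 * (ε ^ 2 * exp (-M)) / Real.sqrt M) :
    0 < X 1 2 * exp (-clockInt ε M X 1) := by
  obtain ⟨-, hM4, -⟩ := negKick_params hK hML hMK hε hεle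
  obtain ⟨hM6000, -⟩ := negKick_params_sharp hK hML hMK hε hεle
  obtain ⟨hε2M, hexp4, h4M, -⟩ := negKick_params_fine hK hML hMK hε hεle
  have hM0 : 0 < M := by linarith
  have hsq0 : 0 < Real.sqrt M := Real.sqrt_pos.2 hM0
  have hsq1 : 1 ≤ Real.sqrt M := by
    rw [show (1 : ℝ) = Real.sqrt 1 by simp]; exact Real.sqrt_le_sqrt (by linarith)
  have hs : 0 < ε ^ 2 * exp (-M) := by positivity
  have hκ3 : κ ≤ 3 * (ε ^ 2 * exp (-M)) := by
    refine hκ.trans ?_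
    rw [div_le_iff₀ hsq0]
    nlinarith
  have h1 := disc_one_ge hK hML hMK hε hεle hX h0 hκ0 hκ3
  have hI := window_mass_ge hM6000
  have hη : 99999 / 100000 ≤ 1 - (ε ^ 2 + 48 * exp (-M)) := by linarith
  have hprod : 99999 / 100000 * (12533 / 10000 / Real.sqrt M) ≤
      (1 - (ε ^ 2 + 48 * exp (-M))) * ∫ r in (0 : ℝ)..1, exp (-(M / 2) * r ^ 2) :=
    mul_le_mul hη hI (by positivity) (by linarith)
  have h2 := mul_le_mul_of_nonneg_left hprod hs.le
  have hnum : 3133 / 2500 * (ε ^ 2 * exp (-M)) / Real.sqrt M <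
      ε ^ 2 * exp (-M) * (99999 / 100000 * (12533 / 10000 / Real.sqrt M)) := by
    rw [show ε ^ 2 * exp (-M) * (99999 / 100000 * (12533 / 10000 / Real.sqrt M)) =
      99999 * 12533 / 1000000000 * (ε ^ 2 * exp (-M)) / Real.sqrt M by ring]
    exact div_lt_div_of_pos_right (by nlinarith) hsq0
  have h3 : ε ^ 2 * exp (-M) * ((1 - (ε ^ 2 + 48 * exp (-M))) *
      ∫ r in (0 : ℝ)..1, exp (-(M / 2) * r ^ 2)) =
      ε ^ 2 * exp (-M) * (1 - (ε ^ 2 + 48 * exp (-M))) *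
        ∫ r in (0 : ℝ)..1, exp (-(M / 2) * r ^ 2) := by ring
  linarith

/-! ## §4. The upper side: the cycle's total deposit is below `1.2535/√M` seeds -/

/-- **The fine trajectory estimate.** For a pre-load in `[-3ε²e^{-M}, 0]` under the standing
hypotheses, the cycle-end discounted trigger is at most `-κ + 1.25349·ε²e^{-M}/√M`
(clock floor `ρ ≥ 1 - 10⁻⁵`, `√(2π)/2 ≤ 1.253315`, tail `≤ 10⁻⁵/√M`). [cite: Tao2016AveragedNS, §5.5] -/
theorem negKick_trajectory_fine (hK : 2 * 20 ^ 42 * (Nat.factorial 42 : ℝ) + 16 ≤ K)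
    (hML : 3000 * Real.log K ≤ M) (hMK : M ≤ K ^ 10) (hε : 0 < ε)
    (hεle : ε ≤ exp (-(10 * M)) / K ^ 100) (hX : ∀ t, HasDerivAt X (delayCircuitWith K M ε (X t)) t)
    (h0 : X 0 = kickInit (-κ)) (hκ0 : 0 ≤ κ) (hκ3 : κ ≤ 3 * (ε ^ 2 * exp (-M))) :
    X 2 2 * exp (-clockInt ε M X 2) ≤
      -κ + 125349 / 100000 * (ε ^ 2 * exp (-M)) / Real.sqrt M := by
  obtain ⟨-, hM4, -, hs3, hsmall, -⟩ := negKick_params hK hML hMK hε hεle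
  obtain ⟨hM6000, -⟩ := negKick_params_sharp hK hML hMK hε hεle
  obtain ⟨hε2M, hexp4, h4M, hMe⟩ := negKick_params_fine hK hML hMK hε hεle
  have hM : 0 ≤ M := by linarith
  have hM0 : 0 < M := by linarith
  have hκsq : (-κ) ^ 2 ≤ 1 := by rw [neg_sq]; nlinarith
  obtain ⟨-, hb, -⟩ := negKick_trajectory hK hML hMK hε hεle hX h0 hκ0 hκ3
  have hGl' := clockInt_ge_unit_fine hK hML hMK hε hεle hX h0 hκ0 hκ3
  obtain ⟨ρ, hρ⟩ : ∃ ρ : ℝ, ρ = 1 - (ε ^ 2 + 48 * exp (-M)) - 16 * M * ε ^ 2 * exp (-M) :=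
    ⟨_, rfl⟩
  have hη2 : 16 * M * ε ^ 2 * exp (-M) ≤ 16 * exp (-M) := by
    have h1 : 16 * M * ε ^ 2 * exp (-M) = 16 * ε ^ 2 * (M * exp (-M)) := by ring
    have h2 : 16 * ε ^ 2 * (M * exp (-M)) ≤ 16 * ε ^ 2 * 1 :=
      mul_le_mul_of_nonneg_left hMe (by positivity)
    linarith
  have hρ1 : 99999 / 100000 ≤ ρ := by rw [hρ]; linarith
  have hρ0 : 0 < ρ := by linarith
  have hl0 : 0 < ρ * M / 2 := by positivity
  have hGl : ∀ u ∈ Icc (0 : ℝ) 1, ρ * M / 2 * u ^ 2 ≤ clockInt ε M X u := fun u hu => by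
    have := hGl' u hu
    rw [hρ]
    linarith
  have hsharp := disc_two_le_sharp hX h0 hκsq hM hε hb hGl
  have hI : ∫ r in (0 : ℝ)..1, exp (-(ρ * M / 2) * r ^ 2) ≤ 125348 / 100000 / Real.sqrt M := by
    refine (integral_exp_neg_mul_sq_le hl0).trans (sqrt_pi_div_le_of hM0 (by norm_num) ?_)
    have h1 : (3141593 : ℝ) / 1000000 ≤ 2 * (125348 / 100000) ^ 2 * ρ := by nlinarith
    have h2 := Real.pi_lt_d6
    norm_num at h2
    have h3 : π * M ≤ 3141593 / 1000000 * M := by nlinarith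
    have h4 : 3141593 / 1000000 * M ≤ 2 * (125348 / 100000) ^ 2 * ρ * M :=
      mul_le_mul_of_nonneg_right h1 hM
    have h5 : 2 * (125348 / 100000 : ℝ) ^ 2 * ρ * M = 4 * (125348 / 100000) ^ 2 * (ρ * M / 2) := by
      ring
    linarith
  have hT : exp (2 * (ε⁻¹ * M * (50 * M * ε ^ 3 * exp (2 * M))) - ρ * M / 2) ≤
      1 / 100000 / Real.sqrt M := by
    have h1 : 2 * (ε⁻¹ * M * (50 * M * ε ^ 3 * exp (2 * M))) = 100 * M ^ 2 * ε ^ 2 * exp (2 * M) := by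
      field_simp; ring
    rw [h1]
    have hl : 499 / 1000 * M ≤ ρ * M / 2 := by nlinarith
    exact (exp_le_exp.2 (sub_le_sub_right hsmall _)).trans (exp_tail_le hM6000 hl)
  have hs0 : 0 ≤ ε ^ 2 * exp (-M) := by positivity
  have h1 := mul_le_mul_of_nonneg_left hI hs0
  have h2 := mul_le_mul_of_nonneg_left hT hs0
  have h3 : ε ^ 2 * exp (-M) * (125348 / 100000 / Real.sqrt M) +
      ε ^ 2 * exp (-M) * (1 / 100000 / Real.sqrt M) =
      125349 / 100000 * (ε ^ 2 * exp (-M)) / Real.sqrt M := by ring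
  linarith only [hsharp, h1, h2, h3.le]

end NegKick

/-! ## §5. The dud threshold, two-sided -/

variable {K M ε : ℝ}

/-- **LOWER SIDE: no dud at or below `1.2532/√M` seeds.** Under the standing hypotheses the
cycle-end trigger of the flow line from `kickInit (-κ)` is POSITIVE for every pre-load
`0 ≤ κ ≤ (3133/2500)ε²e^{-M}/√M`. [cite: Tao2016AveragedNS, Theorem 5.3] -/
theorem cycleEndTrigger_pos_of_le (hK : 2 * 20 ^ 42 * (Nat.factorial 42 : ℝ) + 16 ≤ K)
    (hML : 3000 * Real.log K ≤ M) (hMK : M ≤ K ^ 10) (hε : 0 < ε)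
    (hεle : ε ≤ exp (-(10 * M)) / K ^ 100) {κ : ℝ} (hκ0 : 0 ≤ κ)
    (hκ : κ ≤ 3133 / 2500 * (ε ^ 2 * exp (-M)) / Real.sqrt M) :
    0 < cycleEndTrigger K M ε κ := by
  set X : ℝ → Fin 5 → ℝ := fun s => delayFlowWith K M ε s (kickInit (-κ))
  have hX : ∀ t, HasDerivAt X (delayCircuitWith K M ε (X t)) t := hasDerivAt_delayFlowWith K M ε _
  have hD1 := NegKick.disc_one_pos (X := X) hK hML hMK hε hεle hX (delayFlowWith_zero K M ε _) hκ0 hκ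
  have hD2 := NegKick.disc_monotone hX (show (1 : ℝ) ≤ 2 by norm_num)
  have hpos : 0 < X 2 2 * exp (-NegKick.clockInt ε M X 2) := hD1.trans_le hD2
  have : 0 < X 2 2 := (mul_pos_iff_of_pos_right (exp_pos _)).1 hpos
  simpa [cycleEndTrigger, X] using this

/-- **UPPER SIDE: from `1.2535/√M` seeds the gate stalls.** The cycle-end trigger is NEGATIVE at
every pre-load `κ ∈ [(2507/2000)ε²e^{-M}/√M, 3ε²e^{-M}]`. [cite: Tao2016AveragedNS, Theorem 5.3] -/
theorem cycleEndTrigger_neg_of_ge_fine (hK : 2 * 20 ^ 42 * (Nat.factorial 42 : ℝ) + 16 ≤ K)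
    (hML : 3000 * Real.log K ≤ M) (hMK : M ≤ K ^ 10) (hε : 0 < ε)
    (hεle : ε ≤ exp (-(10 * M)) / K ^ 100) {κ : ℝ}
    (hκ1 : 2507 / 2000 * (ε ^ 2 * exp (-M)) / Real.sqrt M ≤ κ) (hκ3 : κ ≤ 3 * (ε ^ 2 * exp (-M))) :
    cycleEndTrigger K M ε κ < 0 := by
  obtain ⟨-, hM4, -⟩ := negKick_params hK hML hMK hε hεle
  have hM0 : 0 < M := by linarith
  have hsq0 : 0 < Real.sqrt M := Real.sqrt_pos.2 hM0
  have hs : 0 < ε ^ 2 * exp (-M) := by positivity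
  have hκ0 : 0 ≤ κ := le_trans (by positivity) hκ1
  set X : ℝ → Fin 5 → ℝ := fun s => delayFlowWith K M ε s (kickInit (-κ))
  have h2 := NegKick.negKick_trajectory_fine (X := X) hK hML hMK hε hεle
    (hasDerivAt_delayFlowWith K M ε _) (delayFlowWith_zero K M ε _) hκ0 hκ3
  have hq : 125349 / 100000 * (ε ^ 2 * exp (-M)) / Real.sqrt M <
      2507 / 2000 * (ε ^ 2 * exp (-M)) / Real.sqrt M :=
    div_lt_div_of_pos_right (by nlinarith) hsq0
  have hneg : X 2 2 * exp (-NegKick.clockInt ε M X 2) < 0 := by linarith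
  have hpos : 0 < exp (-NegKick.clockInt ε M X 2) := exp_pos _
  have : X 2 2 < 0 := by
    by_contra h
    have h' : 0 ≤ X 2 2 := le_of_not_gt h
    nlinarith [mul_nonneg h' hpos.le]
  simpa [cycleEndTrigger, X] using this

/-- **Every dud lies above `1.2532/√M` seeds**: a pre-load `κ ≥ 0` whose flow line returns the
trigger to zero at the end of the cycle satisfies `κ > (3133/2500)ε²e^{-M}/√M`.
[cite: Tao2016AveragedNS, Theorem 5.3] -/
theorem negativeKick_dud_gt (hK : 2 * 20 ^ 42 * (Nat.factorial 42 : ℝ) + 16 ≤ K)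
    (hML : 3000 * Real.log K ≤ M) (hMK : M ≤ K ^ 10) (hε : 0 < ε)
    (hεle : ε ≤ exp (-(10 * M)) / K ^ 100) {κ : ℝ} (hκ0 : 0 ≤ κ)
    (hzero : delayFlowWith K M ε 2 (kickInit (-κ)) 2 = 0) :
    3133 / 2500 * (ε ^ 2 * exp (-M)) / Real.sqrt M < κ := by
  by_contra hle
  have h := cycleEndTrigger_pos_of_le hK hML hMK hε hεle hκ0 (not_lt.1 hle)
  simp only [cycleEndTrigger, hzero, lt_irrefl] at h

/-- **The negative-kick dud, pinned.** Under the standing hypotheses there is a pre-load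
`κ* ∈ ((3133/2500)ε²e^{-M}/√M, (2507/2000)ε²e^{-M}/√M)` — the window `(1.2532, 1.2535)/√M` seeds
around `√(π/2)/√M = 1.25331…/√M` seeds, i.e. `√(π/2)K⁻⁵` seeds on Tao's `M = K¹⁰` — whose EXACT
flow line returns the trigger to zero at the end of the cycle and keeps `|d|, |ã| ≤ 6e^{-M}` on
`[0,2]`. [cite: Tao2016AveragedNS, Theorem 5.3] -/
theorem exists_negativeKick_dud_pinned (hK : 2 * 20 ^ 42 * (Nat.factorial 42 : ℝ) + 16 ≤ K)
    (hML : 3000 * Real.log K ≤ M) (hMK : M ≤ K ^ 10) (hε : 0 < ε)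
    (hεle : ε ≤ exp (-(10 * M)) / K ^ 100) :
    ∃ κ : ℝ, 3133 / 2500 * (ε ^ 2 * exp (-M)) / Real.sqrt M < κ ∧
      κ < 2507 / 2000 * (ε ^ 2 * exp (-M)) / Real.sqrt M ∧
      delayFlowWith K M ε 2 (kickInit (-κ)) 2 = 0 ∧
      ∀ t ∈ Icc (0 : ℝ) 2,
        delayFlowWith K M ε t (kickInit (-κ)) 2 ≤ 0 ∧
        -(3 * (ε ^ 2 * exp (-M))) ≤ delayFlowWith K M ε t (kickInit (-κ)) 2 ∧
        |delayFlowWith K M ε t (kickInit (-κ)) 3| ≤ 6 * exp (-M) ∧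
        |delayFlowWith K M ε t (kickInit (-κ)) 4| ≤ 6 * exp (-M) := by
  obtain ⟨-, hM4, -⟩ := negKick_params hK hML hMK hε hεle
  have hsq1 : 1 ≤ Real.sqrt M := by
    rw [show (1 : ℝ) = Real.sqrt 1 by simp]; exact Real.sqrt_le_sqrt (by linarith)
  have hsq0 : 0 < Real.sqrt M := by linarith
  have hs : 0 ≤ ε ^ 2 * exp (-M) := by positivity
  have h13 : 2507 / 2000 * (ε ^ 2 * exp (-M)) / Real.sqrt M ≤ 3 * (ε ^ 2 * exp (-M)) := by
    rw [div_le_iff₀ hsq0]; nlinarith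
  obtain ⟨κ, hκ0, hκlt, hzero, hprops⟩ := exists_dud_of_cycleEndTrigger_neg hK hML hMK hε hεle
    (by positivity) h13 (cycleEndTrigger_neg_of_ge_fine hK hML hMK hε hεle le_rfl h13)
  exact ⟨κ, negativeKick_dud_gt hK hML hMK hε hεle hκ0.le hzero, hκlt, hzero, hprops⟩

/-- **The `q = 5` budget is out of the dud's reach, in every member.** A trigger pre-load within
the seed-scale budget of exponent `5`, `0 ≤ κ ≤ ε²e^{-M}/K⁵` (`≤ ε²e^{-M}/√M` as `M ≤ K¹⁰`), does NOT
stall the gate: the cycle-end trigger is positive. (So the witness refuting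
`PseudoOrbitTransitionSeed q` for `q ≤ 4` — a dud pre-load, NegativeKickSharp.lean §3 — cannot
refute `q = 5`; nothing else about `q = 5` is decided here.) [cite: Tao2016AveragedNS, Theorem 5.3] -/
theorem cycleEndTrigger_pos_of_le_pow_five (hK : 2 * 20 ^ 42 * (Nat.factorial 42 : ℝ) + 16 ≤ K)
    (hML : 3000 * Real.log K ≤ M) (hMK : M ≤ K ^ 10) (hε : 0 < ε)
    (hεle : ε ≤ exp (-(10 * M)) / K ^ 100) {κ : ℝ} (hκ0 : 0 ≤ κ)
    (hκ : κ ≤ ε ^ 2 * exp (-M) / K ^ 5) : 0 < cycleEndTrigger K M ε κ := by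
  obtain ⟨hK16, hM4, -⟩ := negKick_params hK hML hMK hε hεle
  have hM0 : 0 < M := by linarith
  have hK0 : 0 < K := by linarith
  have hsq0 : 0 < Real.sqrt M := Real.sqrt_pos.2 hM0
  have hs : 0 ≤ ε ^ 2 * exp (-M) := by positivity
  have hsqK : Real.sqrt M ≤ K ^ 5 := by
    rw [Real.sqrt_le_left (by positivity)]
    calc M ≤ K ^ 10 := hMK
      _ = (K ^ 5) ^ 2 := by ring
  refine cycleEndTrigger_pos_of_le hK hML hMK hε hεle hκ0 (hκ.trans ?_)
  calc ε ^ 2 * exp (-M) / K ^ 5 ≤ ε ^ 2 * exp (-M) / Real.sqrt M :=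
        div_le_div_of_nonneg_left hs hsq0 hsqK
    _ = 1 * (ε ^ 2 * exp (-M)) / Real.sqrt M := by ring
    _ ≤ 3133 / 2500 * (ε ^ 2 * exp (-M)) / Real.sqrt M := by gcongr; norm_num

end Literature.Analysis.FluidPDE.Tao2016AveragedNS
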